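import Mathlib
import Literature.MathematicalPhysics.StatisticalMechanics.Crystallization
import Literature.MathematicalPhysics.StatisticalMechanics.BarlowStacking

/-!
# Sketch — crux PhononStability (stmt-AtomisticToContinuum-9333), ideator 3, round 1

First lemmas of the two idea cards, stated as `Prop`s over existing declarations (nothing is
proved here; the point is that the statements elaborate).

* Card `window-vertex-principle`: `HessSqForm` (the typed `Hess e w` is a two-term form in the
  SQUARED distance `s = ‖e‖²` with explicit signs), `RadialSignStructure` (on the window's bond
  range the isotropic coefficient is concave in `s`, the longitudinal one convex), and the generic
  `VertexPrinciple` (a family of quadratic forms that is concave in a box parameter and PSD at the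
  `2^d` vertices is PSD on the box).
* Card `p1-korn-honeycomb`: `GeometricKorn` (potential-free discrete Korn inequality for
  finitely supported displacements of the strained hcp contact framework, in the crux's own
  normalisation: the unit-stiffness nearest-neighbour BAR form controls the typed NN difference
  norm, uniformly over the admissible window).
-/

namespace Summit.AtomisticToContinuum.Crystallization.Cruxes.PhononStability.Ideator3

open scoped BigOperators
open Literature.MathematicalPhysics.StatisticalMechanics

noncomputable section

/-- Card A, lemma 1 (provable now, calculus): for `e ≠ 0` the typed second variation
`Hess e w = V″(‖e‖)(⟪e,w⟫/‖e‖)² + (V′(‖e‖)/‖e‖)(‖w‖² − (⟪e,w⟫/‖e‖)²)` of `V = lennardJones`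
is the squared-distance form `(−s⁻⁷ + s⁻⁴)‖w‖² + (14 s⁻⁸ − 8 s⁻⁵)⟪e,w⟫²`, `s = ‖e‖²`
(from `V′(r) = −r⁻¹³ + r⁻⁷`, `V″(r) = 13 r⁻¹⁴ − 7 r⁻⁸`). Every window parameter enters the crux
only through this form, bond by bond. -/
def HessSqForm : Prop :=
  ∀ e w : EuclideanSpace ℝ (Fin 3), e ≠ 0 →
    deriv (deriv lennardJones) ‖e‖ * (inner ℝ e w / ‖e‖) ^ 2
        + deriv lennardJones ‖e‖ / ‖e‖ * (‖w‖ ^ 2 - (inner ℝ e w / ‖e‖) ^ 2)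
      = (-((‖e‖ ^ 2)⁻¹) ^ 7 + ((‖e‖ ^ 2)⁻¹) ^ 4) * ‖w‖ ^ 2
        + (14 * ((‖e‖ ^ 2)⁻¹) ^ 8 - 8 * ((‖e‖ ^ 2)⁻¹) ^ 5) * (inner ℝ e w) ^ 2

/-- Card A, lemma 2 (provable now, one-variable calculus): sign structure of the two radial
coefficients on the window's nearest-neighbour range `s = r² ∈ [0.84, 1.05]` (bonds
`r ∈ [0.92, 1.02]`): the isotropic (prestress) coefficient `2f′(s) = −s⁻⁷ + s⁻⁴` is CONCAVE
(`(2f′)″ = s⁻⁹(20 s³ − 56) < 0` for `s³ < 2.8`) and the longitudinal coefficient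
`4f″(s) = 14 s⁻⁸ − 8 s⁻⁵` is CONVEX (`(4f″)″ = s⁻¹⁰(1008 − 240 s³) > 0` for `s³ < 4.2`).
Concave coefficients are kept, convex ones are replaced by tangent lines (exact minorants): this
is what makes `θ ↦ λ_min(D_θ − κ S)` concave in the Gram–shift coordinates of the window. -/
def RadialSignStructure : Prop :=
  ConcaveOn ℝ (Set.Icc (84 / 100 : ℝ) (105 / 100)) (fun s : ℝ => -(s⁻¹) ^ 7 + (s⁻¹) ^ 4) ∧
  ConvexOn ℝ (Set.Icc (84 / 100 : ℝ) (105 / 100)) (fun s : ℝ => 14 * (s⁻¹) ^ 8 - 8 * (s⁻¹) ^ 5)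

/-- Card A, lemma 3 (provable now, convex analysis; the load-bearing logical step): a family of
quadratic forms on `Fin n → ℝ` indexed by a box parameter `θ ∈ [a, b] ⊂ ℝ^d` such that
`θ ↦ xᵀ M(θ) x` is concave on the box for every `x`, and which is positive semidefinite at the
`2^d` vertices, is positive semidefinite on the whole box (a concave function on a polytope
attains its minimum at a vertex). Rohn's vertex theorem for interval matrices is the affine
special case. -/
def VertexPrinciple : Prop :=
  ∀ (n d : ℕ) (M : (Fin d → ℝ) → Matrix (Fin n) (Fin n) ℝ) (a b : Fin d → ℝ),
    a ≤ b →
    (∀ x : Fin n → ℝ, ConcaveOn ℝ (Set.Icc a b) (fun θ => x ⬝ᵥ Matrix.mulVec (M θ) x)) →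
    (∀ θ : Fin d → ℝ, (∀ i, θ i = a i ∨ θ i = b i) → ∀ x : Fin n → ℝ, 0 ≤ x ⬝ᵥ Matrix.mulVec (M θ) x) →
    ∀ θ ∈ Set.Icc a b, ∀ x : Fin n → ℝ, 0 ≤ x ⬝ᵥ Matrix.mulVec (M θ) x

/-- Card B, first lemma (potential-free; the discrete Korn inequality the Fourier-free
certificate rests on), in the crux's own normalisation: there is `c > 0` such that for every
admissible cell `A`, every hcp-like inner displacement `t` and every finitely supported
displacement `u` of the site set, the unit-stiffness nearest-neighbour BAR form
`Σ_{p,q ∈ S, |p−q| ≤ 11/10, p ≠ q} ⟪p − q, u p − u q⟫² / ‖p − q‖²` (longitudinal strains only)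
controls the typed nearest-neighbour difference norm `Σ_{|p−q| ≤ 11/10} ‖u p − u q‖²`.
Proof route of the card: P1-interpolate `u` on the tetrahedral refinement of the hcp
tetrahedron–octahedron honeycomb, Korn's FIRST identity `‖∇ũ‖² = 2‖e(ũ)‖² − ‖div ũ‖²` for
compactly supported `ũ`, and two cell-wise generalized eigenvalue bounds (tetrahedron 12×12,
octahedron 18×18), continuous in the cell shape over the window. -/
def GeometricKorn : Prop :=
  let Λ : Set (EuclideanSpace ℝ (Fin 3)) := {z | ∃ i j k : ℤ, z = (i : ℝ) • triangularVec₁ 1 +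
    (j : ℝ) • triangularVec₂ 1 + (k : ℝ) • layerNormal (2 * Real.sqrt (2 / 3))}
  let Adm : (EuclideanSpace ℝ (Fin 3) →L[ℝ] EuclideanSpace ℝ (Fin 3)) → Prop := fun A =>
    ∃ R : EuclideanSpace ℝ (Fin 3) ≃ₗᵢ[ℝ] EuclideanSpace ℝ (Fin 3),
      ‖A - (97 / 100 : ℝ) • (R.toContinuousLinearEquiv :
        EuclideanSpace ℝ (Fin 3) →L[ℝ] EuclideanSpace ℝ (Fin 3))‖ ≤ 1 / 40
  let Inner : (Fin 2 → EuclideanSpace ℝ (Fin 3)) →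
      (EuclideanSpace ℝ (Fin 3) →L[ℝ] EuclideanSpace ℝ (Fin 3)) → Prop := fun t A =>
    ‖t 1 - t 0 - A (barlowOffset 1 + layerNormal (Real.sqrt (2 / 3)))‖ ≤ 1 / 40
  let Sites : (Fin 2 → EuclideanSpace ℝ (Fin 3)) →
      (EuclideanSpace ℝ (Fin 3) →L[ℝ] EuclideanSpace ℝ (Fin 3)) → Set (EuclideanSpace ℝ (Fin 3)) :=
    fun t A => {p | ∃ m : Fin 2, ∃ z ∈ Λ, p = t m + A z}
  ∃ c : ℝ, 0 < c ∧ ∀ (t : Fin 2 → EuclideanSpace ℝ (Fin 3))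
    (A : EuclideanSpace ℝ (Fin 3) →L[ℝ] EuclideanSpace ℝ (Fin 3)), Adm A → Inner t A →
    ∀ u : EuclideanSpace ℝ (Fin 3) → EuclideanSpace ℝ (Fin 3), (Function.support u).Finite →
      Function.support u ⊆ Sites t A →
      c * (∑' p : Sites t A, ∑' q : Sites t A,
            if dist (p : EuclideanSpace ℝ (Fin 3)) q ≤ 11 / 10 then ‖u p - u q‖ ^ 2 else 0)
        ≤ ∑' p : Sites t A, ∑' q : Sites t A,
            if dist (p : EuclideanSpace ℝ (Fin 3)) q ≤ 11 / 10 ∧ (p : EuclideanSpace ℝ (Fin 3)) ≠ q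
            then inner ℝ ((p : EuclideanSpace ℝ (Fin 3)) - q) (u p - u q) ^ 2
                  / ‖(p : EuclideanSpace ℝ (Fin 3)) - q‖ ^ 2
            else 0

end

end Summit.AtomisticToContinuum.Crystallization.Cruxes.PhononStability.Ideator3
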